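import Mathlib
import HarnessLib
import Summits.HubbardSuperconductivity.HubbardSuperconductivity.Theorems.KLProgrammeC4aAliasJets
import Summits.HubbardSuperconductivity.HubbardSuperconductivity.Theorems.KLProgrammeC4aTadpoleJetAssembly

/-!
# Route `KLProgramme` — crux C4a, the (A)-closer's REMAINDER TERMS: angular jets of `θ ↦ Re localReadingCont β G (k_F^K θ)` for ANY Grassmann element `G`
# (the `R₁` = ≥ 2 self-lines and `R₂` = ≥ 2 vertices terms of `klLocalPart_succ_sub_eq_avg8`) from the position-space MOMENTS of its two-point kernel

Cell `gate-hubbard-kl`, lane hubbard-kl-c4a-1 (g5); helper for stub (C) `stub_twoLeg_curvature` of the engine-flow child `KLRegimeEngineV17F2`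
(stmt-HubbardSuperconductivity-20437); memo HOME/hubbard-kl-c4a-1/C4A-PLAN.md §22.3 (iii).  `…C4aAvg8Jets.twoLegCurveJetBound_succ_of_jets` asks for the jets of
`Re[tadpoleCont + localReadingCont R₁ + localReadingCont R₂] ∘ k_F^K`; the one-line part is `…C4aTadpoleJetAssembly`; here the two remainder readings.  Since
`selfEnergyCont β G q₀ σ P = 2βL²·|Λ|⁻²·Σ_x W₂(x)·e^{iω(t₀−t₁)}·e^{iP·(x⃗₀−x⃗₁)~}` is a character polynomial whose frequencies are the RANGES `x⃗₀ − x⃗₁` of the kernel,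
each derivative in `P` costs one power of `|x̃₀ − x̃₁|₁` — the position-space moments that the (b)-tower's decay norms control (`≍ Λ_n^{−k}·‖W₂‖`):

* §1 `norm_iteratedFDeriv_planeWave_le_absSum` (`‖Dᵏ_P e^{iP·z̃}‖ ≤ |z̃|₁ᵏ`, the sharp form of `…C4aAliasJets.norm_iteratedFDeriv_planeWave_le`);
* §2 `selfEnergyCont_ofLp_eq`, `contDiff_selfEnergyCont_ofLp`, **`norm_iteratedFDeriv_selfEnergyCont_le`**:
  `‖Dᵏ_P selfEnergyCont β G q₀ σ P‖ ≤ 2|β|L²·|Λ|⁻²·Σ_x ‖W₂^{σ}(x)‖·|(x⃗₀−x⃗₁)~|₁ᵏ` (uniform in `q₀`, `P`);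
  **`norm_iteratedFDeriv_localReadingCont_le`**: `‖Dᵏ_P localReadingCont β G P‖ ≤ ½Σ_σ 2|β|L²|Λ|⁻²Σ_x‖W₂^{σ}(x)‖·|x̃₀−x̃₁|₁ᵏ =: twoPointMoment`;
* §3 **`abs_iteratedDeriv_re_localReadingCont_comp_le`** — along any `C⁴` curve `γ` with `‖γ⁽ⁱ⁾‖ ≤ D_i` (the Fermi-point map), for `j ≤ 4`:
  `|∂ʲ Re localReadingCont β G (γ θ)| ≤ bell4 (k ↦ twoPointMoment β G k) D j` (`abs_iteratedDeriv_comp_le_bell`; value at `j = 0`).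

Composition only; the moments are what the (b)-tower must bound for `G ∈ {R₁, R₂}`; nothing is asserted about the Hubbard model's sizes; nothing asserts
superconductivity.  References: BGM 2006 §2.3 (2.17), §2.4 (2.36)–(2.42) (sector-compatible growth: a derivative costs the range) [cite: BenfattoGiulianiMastropietro2006].
-/

noncomputable section

namespace Summit.HubbardSuperconductivity.HubbardSuperconductivity.Theorems.C4a

set_option linter.dupNamespace false -- summit = problem name (single-conjunct summit), D-0017

open Real Set Finset
open scoped ContDiff
open Literature.MathematicalPhysics.QuantumLattice Literature.Probability.LatticeModels GrassmannAlgebra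
open Summit.HubbardSuperconductivity.HubbardSuperconductivity.Theorems.KLRegimeSplit
open Summit.HubbardSuperconductivity.HubbardSuperconductivity.Theorems.DispersionFlow
open Summit.HubbardSuperconductivity.HubbardSuperconductivity.Theorems.PerturbedFermiCurve

variable {L M : ℕ} [NeZero L] [NeZero M]

/-! ## §1 The sharp plane-wave jet: one derivative costs the `ℓ¹` size of the frequency -/

omit [NeZero L] [NeZero M] in
/-- **`‖Dᵏ_P e^{i Σ_j P_j z̃_j}‖ ≤ (|z̃₀| + |z̃₁|)ᵏ`** — each derivative in the external momentum costs the `ℓ¹` range of the frequency.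
[cite: BenfattoGiulianiMastropietro2006, §2.4 (2.42)] -/
theorem norm_iteratedFDeriv_planeWave_le_absSum (z : TorusSite 2 L) (k : ℕ) (P : Momentum) :
    ‖iteratedFDeriv ℝ k (fun P : Momentum => Complex.exp (((∑ j, (WithLp.ofLp P) j * ((z j).valMinAbs : ℝ) : ℝ) : ℂ) * Complex.I)) P‖ ≤
      (absSum (fun j => (z j).valMinAbs)) ^ k := by
  have hcexp : ∀ (i : ℕ) (w : ℂ), ‖iteratedFDeriv ℝ i Complex.exp w‖ = Real.exp w.re := fun i w => by
    have h := (Complex.contDiff_exp (𝕜 := ℂ) (n := i)).contDiffAt (x := w)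
    rw [← h.restrictScalars_iteratedFDeriv (𝕜 := ℝ), Function.comp_apply, ContinuousMultilinearMap.norm_restrictScalars,
      norm_iteratedFDeriv_eq_norm_iteratedDeriv, iteratedDeriv_eq_iterate, Complex.iter_deriv_exp, Complex.norm_exp]
  rw [planeWave_eq_cexp_comp, ((intForm (ι := Fin 2) (fun j => (z j).valMinAbs)).smulRight Complex.I).iteratedFDeriv_comp_right
    Complex.contDiff_exp P (i := k) (by exact_mod_cast le_top)]
  refine (ContinuousMultilinearMap.norm_compContinuousLinearMap_le _ _).trans ?_
  rw [hcexp, Finset.prod_const, Finset.card_univ, Fintype.card_fin]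
  have hre : (((intForm (ι := Fin 2) (fun j => (z j).valMinAbs)).smulRight Complex.I) P).re = 0 := by
    simp [ContinuousLinearMap.smulRight_apply, Complex.real_smul]
  rw [hre, Real.exp_zero, one_mul]
  refine pow_le_pow_left₀ (norm_nonneg _) ?_ k
  rw [ContinuousLinearMap.norm_smulRight_apply, Complex.norm_I, mul_one]
  exact norm_intForm_le _

omit [NeZero L] [NeZero M] in
/-- Constant multiples: `‖Dᵏ_P [a·e^{iP·z̃}]‖ ≤ ‖a‖·|z̃|₁ᵏ`. -/
theorem norm_iteratedFDeriv_const_mul_planeWave_le_absSum (a : ℂ) (z : TorusSite 2 L) (k : ℕ) (P : Momentum) :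
    ‖iteratedFDeriv ℝ k (fun P : Momentum => a * Complex.exp (((∑ j, (WithLp.ofLp P) j * ((z j).valMinAbs : ℝ) : ℝ) : ℂ) * Complex.I)) P‖ ≤
      ‖a‖ * (absSum (fun j => (z j).valMinAbs)) ^ k := by
  have h : (fun P : Momentum => a * Complex.exp (((∑ j, (WithLp.ofLp P) j * ((z j).valMinAbs : ℝ) : ℝ) : ℂ) * Complex.I)) =
      fun P => a • Complex.exp (((∑ j, (WithLp.ofLp P) j * ((z j).valMinAbs : ℝ) : ℝ) : ℂ) * Complex.I) := rfl
  rw [h, iteratedFDeriv_const_smul_apply' ((contDiff_planeWave z (N := k)).contDiffAt), norm_smul]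
  exact mul_le_mul_of_nonneg_left (norm_iteratedFDeriv_planeWave_le_absSum z k P) (norm_nonneg _)

/-! ## §2 Fréchet jets of the continuum two-point reading from position-space moments -/

/-- **The position-space moment of order `k`** of the two-point kernel of `G` at spin `σ`:
`twoPointMomentAt β G σ k = 2|β|L²·|Λ|⁻²·Σ_{x₀,x₁} ‖W₂((x₀,σ,+),(x₁,σ,−))‖·|(x⃗₀ − x⃗₁)~|₁ᵏ` (centred `ℓ¹` range to the power `k`). -/
def twoPointMomentAt (β : ℝ) (G : HubbardGrassmann L M) (σ : Fin 2) (k : ℕ) : ℝ :=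
  2 * |β| * (L : ℝ) ^ 2 * (((Fintype.card (SpaceTimeIdx L M) : ℝ) ^ 2)⁻¹ *
    ∑ x : Fin 2 → SpaceTimeIdx L M, ‖positionKernel L M β G 2 (fun i => ((x i, ![σ, σ] i), (![0, 1] : Fin 2 → Fin 2) i))‖ *
      (absSum (fun j => ((((x 0).2 - (x 1).2) j).valMinAbs))) ^ k)

/-- **The moment bounding the localised reading's jets**: `twoPointMoment β G k = ½ Σ_σ twoPointMomentAt β G σ k` (both external frequencies `±ω₀` contribute the same
norm; the `¼Σ_σ` of the localisation). -/
def twoPointMoment (β : ℝ) (G : HubbardGrassmann L M) (k : ℕ) : ℝ := (1 / 2) * ∑ σ : Fin 2, twoPointMomentAt β G σ k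

omit [NeZero M] in
/-- `twoPointMomentAt ≥ 0`. -/
theorem twoPointMomentAt_nonneg (β : ℝ) (G : HubbardGrassmann L M) (σ : Fin 2) (k : ℕ) : 0 ≤ twoPointMomentAt β G σ k := by
  unfold twoPointMomentAt
  refine mul_nonneg (by positivity) (mul_nonneg (by positivity) (Finset.sum_nonneg fun x _ => mul_nonneg (norm_nonneg _) ?_))
  exact pow_nonneg (absSum_nonneg _) _

omit [NeZero M] in
/-- The continuum two-point reading, read on `Momentum`, as a constant multiple of a sum of (constant × plane wave). -/
theorem selfEnergyCont_ofLp_eq (β : ℝ) (G : HubbardGrassmann L M) (q₀ : MatsubaraIdx M) (σ : Fin 2) :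
    (fun P : Momentum => selfEnergyCont β G q₀ σ (WithLp.ofLp P)) = fun P : Momentum =>
      (((((2 : ℕ).factorial : ℝ) * (β * (L : ℝ) ^ 2) ^ (2 - 1) : ℝ) : ℂ) * ((Fintype.card (SpaceTimeIdx L M) : ℂ) ^ 2)⁻¹) •
        ∑ x : Fin 2 → SpaceTimeIdx L M,
          (positionKernel L M β G 2 (fun i => ((x i, ![σ, σ] i), (![0, 1] : Fin 2 → Fin 2) i)) *
              Complex.exp (((matsubaraFreq β M q₀ * (imagTime β M (x 0).1 - imagTime β M (x 1).1) : ℝ) : ℂ) * Complex.I)) *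
            Complex.exp (((∑ j, (WithLp.ofLp P) j * ((((x 0).2 - (x 1).2) j).valMinAbs : ℝ) : ℝ) : ℂ) * Complex.I) := by
  funext P
  unfold selfEnergyCont
  rw [smul_eq_mul, mul_assoc]
  congr 2
  exact Finset.sum_congr rfl fun x _ => by ring

omit [NeZero M] in
/-- The continuum two-point reading is `C^∞` in the external momentum. -/
theorem contDiff_selfEnergyCont_ofLp (β : ℝ) (G : HubbardGrassmann L M) (q₀ : MatsubaraIdx M) (σ : Fin 2) {N : ℕ∞} :
    ContDiff ℝ N fun P : Momentum => selfEnergyCont β G q₀ σ (WithLp.ofLp P) := by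
  rw [selfEnergyCont_ofLp_eq]
  exact (ContDiff.sum fun x _ => contDiff_const.mul (contDiff_planeWave _)).const_smul _

omit [NeZero M] in
/-- **FRÉCHET JETS OF THE CONTINUUM TWO-POINT READING FROM POSITION-SPACE MOMENTS**: for every frequency label `q₀` and external momentum `P`,
`‖Dᵏ_P selfEnergyCont β G q₀ σ P‖ ≤ twoPointMomentAt β G σ k` — one derivative costs one power of the kernel's range. [cite: BenfattoGiulianiMastropietro2006, §2.4 (2.42)] -/
theorem norm_iteratedFDeriv_selfEnergyCont_le (β : ℝ) (G : HubbardGrassmann L M) (q₀ : MatsubaraIdx M) (σ : Fin 2) (k : ℕ) (P : Momentum) :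
    ‖iteratedFDeriv ℝ k (fun P : Momentum => selfEnergyCont β G q₀ σ (WithLp.ofLp P)) P‖ ≤ twoPointMomentAt β G σ k := by
  have hterm : ∀ x : Fin 2 → SpaceTimeIdx L M, ContDiff ℝ k fun P : Momentum =>
      (positionKernel L M β G 2 (fun i => ((x i, ![σ, σ] i), (![0, 1] : Fin 2 → Fin 2) i)) *
          Complex.exp (((matsubaraFreq β M q₀ * (imagTime β M (x 0).1 - imagTime β M (x 1).1) : ℝ) : ℂ) * Complex.I)) *
        Complex.exp (((∑ j, (WithLp.ofLp P) j * ((((x 0).2 - (x 1).2) j).valMinAbs : ℝ) : ℝ) : ℂ) * Complex.I) :=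
    fun x => contDiff_const.mul (contDiff_planeWave _)
  have hconst : ‖((((2 : ℕ).factorial : ℝ) * (β * (L : ℝ) ^ 2) ^ (2 - 1) : ℝ) : ℂ) * ((Fintype.card (SpaceTimeIdx L M) : ℂ) ^ 2)⁻¹‖ =
      2 * |β| * (L : ℝ) ^ 2 * ((Fintype.card (SpaceTimeIdx L M) : ℝ) ^ 2)⁻¹ := by
    rw [norm_mul, norm_inv, norm_pow, Complex.norm_natCast, Complex.norm_real, Real.norm_eq_abs,
      show ((((2 : ℕ).factorial : ℝ) * (β * (L : ℝ) ^ 2) ^ (2 - 1) : ℝ)) = 2 * β * (L : ℝ) ^ 2 by norm_num [Nat.factorial]; ring,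
      abs_mul, abs_mul, abs_of_nonneg (by norm_num : (0 : ℝ) ≤ 2), abs_of_nonneg (by positivity : (0 : ℝ) ≤ (L : ℝ) ^ 2)]
  rw [selfEnergyCont_ofLp_eq, iteratedFDeriv_const_smul_apply' ((ContDiff.sum fun x _ => hterm x).contDiffAt), norm_smul, hconst,
    iteratedFDeriv_fun_sum_apply fun x _ => (hterm x).contDiffAt]
  unfold twoPointMomentAt
  rw [← mul_assoc (2 * |β| * (L : ℝ) ^ 2)]
  refine mul_le_mul_of_nonneg_left ((norm_sum_le _ _).trans (Finset.sum_le_sum fun x _ => ?_)) (by positivity)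
  refine (norm_iteratedFDeriv_const_mul_planeWave_le_absSum _ _ k P).trans (le_of_eq ?_)
  rw [norm_mul, Complex.norm_exp_ofReal_mul_I, mul_one]

/-- The continuum localised reading is `C^∞` in the external momentum. -/
theorem contDiff_localReadingCont_ofLp (β : ℝ) (G : HubbardGrassmann L M) {N : ℕ∞} :
    ContDiff ℝ N fun P : Momentum => localReadingCont β G (WithLp.ofLp P) := by
  unfold localReadingCont
  exact (ContDiff.sum fun σ _ => (contDiff_selfEnergyCont_ofLp β G _ σ).add (contDiff_selfEnergyCont_ofLp β G _ σ)).div_const _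

/-- **FRÉCHET JETS OF THE LOCALISED READING**: `‖Dᵏ_P localReadingCont β G P‖ ≤ twoPointMoment β G k`. [cite: BenfattoGiulianiMastropietro2006, §2.4 (2.42)] -/
theorem norm_iteratedFDeriv_localReadingCont_le (β : ℝ) (G : HubbardGrassmann L M) (k : ℕ) (P : Momentum) :
    ‖iteratedFDeriv ℝ k (fun P : Momentum => localReadingCont β G (WithLp.ofLp P)) P‖ ≤ twoPointMoment β G k := by
  have hs : ∀ (q₀ : MatsubaraIdx M) (σ : Fin 2), ContDiff ℝ k fun P : Momentum => selfEnergyCont β G q₀ σ (WithLp.ofLp P) :=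
    fun q₀ σ => contDiff_selfEnergyCont_ofLp β G q₀ σ
  have hpair : ∀ σ : Fin 2, ContDiff ℝ k fun P : Momentum =>
      selfEnergyCont β G (omega0 M) σ (WithLp.ofLp P) + selfEnergyCont β G (omega0 M).rev σ (WithLp.ofLp P) := fun σ => (hs _ σ).add (hs _ σ)
  have hsum : ContDiff ℝ k fun P : Momentum => ∑ σ : Fin 2,
      (selfEnergyCont β G (omega0 M) σ (WithLp.ofLp P) + selfEnergyCont β G (omega0 M).rev σ (WithLp.ofLp P)) := ContDiff.sum fun σ _ => hpair σ
  have hfun : (fun P : Momentum => localReadingCont β G (WithLp.ofLp P)) = fun P : Momentum => ((1 / 4 : ℝ) : ℂ) •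
      ∑ σ : Fin 2, (selfEnergyCont β G (omega0 M) σ (WithLp.ofLp P) + selfEnergyCont β G (omega0 M).rev σ (WithLp.ofLp P)) := by
    funext P
    unfold localReadingCont
    rw [smul_eq_mul, div_eq_mul_inv, mul_comm]
    norm_num
  rw [hfun, iteratedFDeriv_const_smul_apply' hsum.contDiffAt, norm_smul, Complex.norm_real, Real.norm_of_nonneg (by norm_num : (0 : ℝ) ≤ 1 / 4),
    iteratedFDeriv_fun_sum_apply fun σ _ => (hpair σ).contDiffAt]
  unfold twoPointMoment
  rw [show (1 / 2 : ℝ) * ∑ σ : Fin 2, twoPointMomentAt β G σ k = (1 / 4) * ∑ σ : Fin 2, (twoPointMomentAt β G σ k + twoPointMomentAt β G σ k) by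
    rw [Finset.sum_add_distrib]; ring]
  refine mul_le_mul_of_nonneg_left ((norm_sum_le _ _).trans (Finset.sum_le_sum fun σ _ => ?_)) (by norm_num)
  rw [fun_iteratedFDeriv_add_apply (hs _ σ).contDiffAt (hs _ σ).contDiffAt]
  exact (norm_add_le _ _).trans (add_le_add (norm_iteratedFDeriv_selfEnergyCont_le β G _ σ k P) (norm_iteratedFDeriv_selfEnergyCont_le β G _ σ k P))

/-! ## §3 Angular jets along the Fermi curve by Bell's formula -/

/-- **ANGULAR JETS OF A REMAINDER READING ALONG A CURVE.**  For any Grassmann element `G` (the `R₁`, `R₂` of `klLocalPart_succ_sub_eq_avg8`), any `C⁴` curve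
`γ : ℝ → Momentum` with `‖γ⁽ⁱ⁾(θ)‖ ≤ D_i` (the Fermi-point map) and `j ≤ 4`:
`|∂_θʲ Re localReadingCont β G (γ θ)| ≤ bell4 (twoPointMoment β G) D j` — position-space moments of orders `≤ j` against the curve's sizes.
[cite: BenfattoGiulianiMastropietro2006, §2.4 (2.36)–(2.42)] -/
theorem abs_iteratedDeriv_re_localReadingCont_comp_le (β : ℝ) (G : HubbardGrassmann L M) {γ : ℝ → Momentum} (hγ : ContDiff ℝ 4 γ) {θ : ℝ}
    {D : ℕ → ℝ} (hD : ∀ i, 1 ≤ i → i ≤ 4 → ‖iteratedDeriv i γ θ‖ ≤ D i) {j : ℕ} (hj : j ≤ 4) :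
    |iteratedDeriv j ((fun P : Momentum => (localReadingCont β G (WithLp.ofLp P)).re) ∘ γ) θ| ≤ bell4 (twoPointMoment β G) D j := by
  have hG : ContDiff ℝ 4 (fun P : Momentum => localReadingCont β G (WithLp.ofLp P)) := contDiff_localReadingCont_ofLp β G
  have hF : ContDiff ℝ 4 (fun P : Momentum => (localReadingCont β G (WithLp.ofLp P)).re) := Complex.reCLM.contDiff.comp hG
  have hM : ∀ k, 1 ≤ k → k ≤ 4 → ‖iteratedFDeriv ℝ k (fun P : Momentum => (localReadingCont β G (WithLp.ofLp P)).re) (γ θ)‖ ≤ twoPointMoment β G k := by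
    intro k _ hk4
    have hcomp : (fun P : Momentum => (localReadingCont β G (WithLp.ofLp P)).re) = ⇑Complex.reCLM ∘ fun P : Momentum => localReadingCont β G (WithLp.ofLp P) := rfl
    rw [hcomp]
    refine (Complex.reCLM.norm_iteratedFDeriv_comp_left hG.contDiffAt (by exact_mod_cast hk4)).trans ?_
    rw [Complex.reCLM_norm, one_mul]
    exact norm_iteratedFDeriv_localReadingCont_le β G k (γ θ)
  obtain ⟨b1, b2, b3, b4⟩ := abs_iteratedDeriv_comp_le_bell hF hγ hM hD
  interval_cases j
  · simp only [iteratedDeriv_zero, Function.comp_apply, bell4]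
    refine (Complex.abs_re_le_norm _).trans ?_
    have h0 := norm_iteratedFDeriv_localReadingCont_le β G 0 (γ θ)
    rwa [norm_iteratedFDeriv_zero] at h0
  · exact b1
  · exact b2
  · exact b3
  · exact b4

/-- The same along the frame's Fermi-point map `γ = toLp ∘ k_F^K`, in the shape `θ ↦ Re localReadingCont β G (klFermiPoint μ K θ)` of `klLocalPart_succ_sub_eq_avg8`. -/
theorem abs_iteratedDeriv_re_localReadingCont_klFermiPoint_le (β μ : ℝ) (K : TrigPolyC4v) (G : HubbardGrassmann L M)
    (hγ : ContDiff ℝ 4 fun θ : ℝ => (WithLp.toLp 2 (klFermiPoint μ K θ) : Momentum)) {θ : ℝ} {D : ℕ → ℝ}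
    (hD : ∀ i, 1 ≤ i → i ≤ 4 → ‖iteratedDeriv i (fun θ : ℝ => (WithLp.toLp 2 (klFermiPoint μ K θ) : Momentum)) θ‖ ≤ D i) {j : ℕ} (hj : j ≤ 4) :
    |iteratedDeriv j (fun θ : ℝ => (localReadingCont β G (klFermiPoint μ K θ)).re) θ| ≤ bell4 (twoPointMoment β G) D j := by
  have hfun : (fun θ : ℝ => (localReadingCont β G (klFermiPoint μ K θ)).re) =
      (fun P : Momentum => (localReadingCont β G (WithLp.ofLp P)).re) ∘ fun θ : ℝ => (WithLp.toLp 2 (klFermiPoint μ K θ) : Momentum) := by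
    funext θ'; simp
  rw [hfun]
  exact abs_iteratedDeriv_re_localReadingCont_comp_le β G hγ hD hj

end Summit.HubbardSuperconductivity.HubbardSuperconductivity.Theorems.C4a

end
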